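import Mathlib
import Summits.NavierStokesRegularity.NavierStokesRegularity.Theorems.TaoLadderRungTwoBreakOneShiftFrameRows
import Summits.NavierStokesRegularity.NavierStokesRegularity.Theorems.TaoLadderRungTwoBreakCircuitTableDefs
import HarnessLib

/-!
# The time-Lipschitz functional `quadTermLip` of the COMPARABLE CIRCUIT TABLE in closed form
# (cell harvest/h2-tao-ladder, seat p2; instance arithmetic for the STAGE-3 chain `…_v7s`;
# support for K1(1) = `NoSurvivingDSSOne`, stmt-NavierStokesRegularity-20205)

MODEL lattice tables only; nothing about the Navier–Stokes equations; no item closed.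

`quadTermLip ε₀ α A D i n = Σ_{i₁,i₂,μ∈S} |α_{i₁i₂iμ}| (1+ε₀)^{5(n-μ₃)/2} (D_a A_b + A_a D_b)` (module
`…OneShiftTailEstimates`) is the shell-wise Lipschitz functional whose values at the two BOUNDARY shells
`n = -1` and `n = W` are finite hypotheses (`hRBm1`, `hRBW`, `hrowB`, `hrowT`) of the instantiable end
`exists_surviving_dssWave_of_windowCert_v7s` of the one-shift Banach chain.  For the circuit table
`circuitTable ρ p q g k` (module `…CircuitTableDefs`) the 64-term sum collapses, per receiving mode, to
* mode `a = 0`: `2(|ρ|+|p|+|q|) Λ₀ⁿ Aₙ Dₙ + 2|k| Λ₀ⁿ⁻¹ Aₙ₋₁ Dₙ₋₁` (intra-shell products + hand-off from below),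
* mode `b = 1`: `2(|p|+|g|) Λ₀ⁿ Aₙ Dₙ`,  mode `c = 2`: `2(|q|+|g|) Λ₀ⁿ Aₙ Dₙ`,
* mode `d = 3`: `2|ρ| Λ₀ⁿ Aₙ Dₙ + |k| Λ₀ⁿ (Dₙ Aₙ₊₁ + Aₙ Dₙ₊₁)` (rotor + back-reaction from above),
with `Λ₀ = bigLam ε₀ = (1+ε₀)^{5/2}`.  This is the companion of `tableAbsSum_circuitTable` (module
`…CircuitTableAbsSum`).  `quadTermLip_le_of_bounds` is the uniform envelope (any table): if `0 ≤ A ≤ Ā`,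
`0 ≤ D ≤ D̄` on the three shells read at `n`, then `quadTermLip ε₀ α A D i n ≤ 2 (Σ|α|_i) Λ₀ⁿ Ā D̄` — which is
what makes the boundary rows of `…_v7s` decidable by rational arithmetic in an instance.
-/

noncomputable section

-- the sub-problem namespace repeats the summit name by design (D-0017)
set_option linter.dupNamespace false

namespace Summit.NavierStokesRegularity.NavierStokesRegularity.Theorems

namespace DSSOneShift

open Literature.Analysis.FluidPDE Literature.Analysis.FluidPDE.TaoCascade

variable {m : ℕ}

namespace OneShiftFrame

/-- **`quadTermLip` of the circuit table, per receiving mode, in closed form** (any constants, any amplitude /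
distance functions `A`, `D`, any shell `n`; gains written as integer powers of `Λ₀ = bigLam ε₀`).
[cite: Tao2016AveragedNS, §4 (4.1), (4.8) and §5 (the four-mode circuit); cell vocabulary, harvest/h2-tao-ladder rung1/KERNEL-STAGE3-PLAN.md §6 (rows hRBm1/hRBW/hrowB/hrowT)] -/
theorem quadTermLip_circuitTable {ε₀ : ℝ} (hε : 0 < 1 + ε₀) (ρ p q g k : ℝ) (A D : ℤ → ℝ) (n : ℤ) :
    quadTermLip ε₀ (circuitTable ρ p q g k) A D 0 n =
        2 * (|ρ| + |p| + |q|) * bigLam ε₀ ^ n * (A n * D n) +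
          2 * |k| * bigLam ε₀ ^ (n - 1) * (A (n - 1) * D (n - 1)) ∧
    quadTermLip ε₀ (circuitTable ρ p q g k) A D 1 n = 2 * (|p| + |g|) * bigLam ε₀ ^ n * (A n * D n) ∧
    quadTermLip ε₀ (circuitTable ρ p q g k) A D 2 n = 2 * (|q| + |g|) * bigLam ε₀ ^ n * (A n * D n) ∧
    quadTermLip ε₀ (circuitTable ρ p q g k) A D 3 n =
        2 * |ρ| * bigLam ε₀ ^ n * (A n * D n) +
          |k| * bigLam ε₀ ^ n * (D n * A (n + 1) + A n * D (n + 1)) := by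
  have hS : ∀ f : ℤ × ℤ × ℤ → ℝ,
      ∑ μ ∈ shiftSet, f μ = f (0, 0, 0) + f (1, 0, 0) + f (0, 1, 0) + f (0, 0, 1) := by
    intro f
    simp [shiftSet, Finset.sum_insert, add_assoc]
  have e0 : (1 + ε₀) ^ ((5 : ℝ) * (n : ℝ) / 2) = bigLam ε₀ ^ n := bigLam_zpow_eq_rpow hε n
  have e1 : (1 + ε₀) ^ ((5 : ℝ) * ((n : ℝ) - 1) / 2) = bigLam ε₀ ^ (n - 1) := by
    have h := bigLam_zpow_eq_rpow hε (n - 1)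
    push_cast at h
    exact h
  simp only [quadTermLip, hS, Fin.sum_univ_four]
  simp (config := { decide := true }) only [circuitTable, if_true, if_false, abs_zero, zero_mul, add_zero,
    zero_add, abs_neg, abs_div, abs_two, Int.cast_zero, Int.cast_one, sub_zero, e0, e1]
  refine ⟨by ring, by ring, by ring, by ring⟩

/-- **Uniform envelope of `quadTermLip` at one shell.** If on the three shells `n-1, n, n+1` read at shell `n`
the amplitude bounds are `0 ≤ A ≤ Ā` and the distance coefficients `0 ≤ D ≤ D̄`, then (for `Λ₀ ≥ 1`, so that the
hand-off gain `Λ₀^{n-1}` is at most `Λ₀ⁿ`) `quadTermLip ε₀ α A D i n ≤ 2 (Σ_{i₁i₂μ}|α_{i₁i₂iμ}|) Λ₀ⁿ Ā D̄` — any table.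
[cite: Tao2016AveragedNS, §4 (4.8); cell vocabulary, harvest/h2-tao-ladder rung1/STAGE3-BANACH.md §2 (Lip(k ← k′)), module …OneShiftFrameRows (`quadTermLip_wake_le`, same estimate on a geometric frame)] -/
theorem quadTermLip_le_of_bounds {ε₀ : ℝ} (hε : 0 < 1 + ε₀) (hΛ1 : 1 ≤ bigLam ε₀)
    (α : Fin m → Fin m → Fin m → ℤ × ℤ × ℤ → ℝ) {A D : ℤ → ℝ} {n : ℤ} {Ab Db : ℝ}
    (hA0 : ∀ k', n - 1 ≤ k' → k' ≤ n + 1 → 0 ≤ A k') (hD0 : ∀ k', n - 1 ≤ k' → k' ≤ n + 1 → 0 ≤ D k')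
    (hA : ∀ k', n - 1 ≤ k' → k' ≤ n + 1 → A k' ≤ Ab) (hD : ∀ k', n - 1 ≤ k' → k' ≤ n + 1 → D k' ≤ Db)
    (i : Fin m) :
    quadTermLip ε₀ α A D i n ≤ 2 * tableAbsSum α i * bigLam ε₀ ^ n * (Ab * Db) := by
  have hΛpos : 0 < bigLam ε₀ := bigLam_pos (by linarith)
  have hAb : 0 ≤ Ab := (hA0 n (by omega) (by omega)).trans (hA n (by omega) (by omega))
  have hDb : 0 ≤ Db := (hD0 n (by omega) (by omega)).trans (hD n (by omega) (by omega))
  have h1 : quadTermLip ε₀ α A D i n ≤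
      ∑ i₁ : Fin m, ∑ i₂ : Fin m, ∑ μ ∈ shiftSet, |α i₁ i₂ i μ| * ((bigLam ε₀) ^ n * (Db * Ab + Ab * Db)) := by
    unfold quadTermLip
    refine Finset.sum_le_sum fun i₁ _ => Finset.sum_le_sum fun i₂ _ => Finset.sum_le_sum fun μ hμ => ?_
    obtain ⟨⟨ha1, ha2⟩, ⟨hb1, hb2⟩, ⟨_, hg2⟩⟩ := shiftSet_index_bounds hμ n
    have hgain : (1 + ε₀) ^ ((5 : ℝ) * (n - μ.2.2) / 2) ≤ (bigLam ε₀) ^ n := by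
      have e := bigLam_zpow_eq_rpow hε (n - μ.2.2)
      push_cast at e
      rw [e]
      exact zpow_le_zpow_right₀ hΛ1 hg2
    have hprod : D (n - μ.2.2 + μ.1) * A (n - μ.2.2 + μ.2.1) + A (n - μ.2.2 + μ.1) * D (n - μ.2.2 + μ.2.1) ≤
        Db * Ab + Ab * Db :=
      add_le_add (mul_le_mul (hD _ ha1 ha2) (hA _ hb1 hb2) (hA0 _ hb1 hb2) hDb)
        (mul_le_mul (hA _ ha1 ha2) (hD _ hb1 hb2) (hD0 _ hb1 hb2) hAb)
    have hα0 : 0 ≤ |α i₁ i₂ i μ| := abs_nonneg _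
    have hpn : 0 ≤ D (n - μ.2.2 + μ.1) * A (n - μ.2.2 + μ.2.1) + A (n - μ.2.2 + μ.1) * D (n - μ.2.2 + μ.2.1) :=
      add_nonneg (mul_nonneg (hD0 _ ha1 ha2) (hA0 _ hb1 hb2)) (mul_nonneg (hA0 _ ha1 ha2) (hD0 _ hb1 hb2))
    rw [mul_assoc]
    refine mul_le_mul_of_nonneg_left ?_ hα0
    exact mul_le_mul hgain hprod hpn (zpow_nonneg hΛpos.le _)
  calc quadTermLip ε₀ α A D i n
      ≤ ∑ i₁ : Fin m, ∑ i₂ : Fin m, ∑ μ ∈ shiftSet, |α i₁ i₂ i μ| * ((bigLam ε₀) ^ n * (Db * Ab + Ab * Db)) := h1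
    _ = tableAbsSum α i * ((bigLam ε₀) ^ n * (Db * Ab + Ab * Db)) := by
        unfold tableAbsSum; simp only [Finset.sum_mul]
    _ = 2 * tableAbsSum α i * bigLam ε₀ ^ n * (Ab * Db) := by ring

end OneShiftFrame

end DSSOneShift

end Summit.NavierStokesRegularity.NavierStokesRegularity.Theorems
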